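import Literature.Topology.PlaneTopology.ArgumentIncrement
import Mathlib.Analysis.Convex.Contractible
import Mathlib.Analysis.Complex.Convex
import Mathlib.Topology.Order.AtTopBotIxx
import Mathlib.Analysis.SpecialFunctions.Complex.Arg
import HarnessLib

/-!
# Hopf's Umlaufsatz for simple closed polygons

Topic: Topology / PlaneTopology (companion to `WindingNumber.lean`, `ArgumentIncrement.lean`).
H. Hopf, *Über die Drehung der Tangenten und Sehnen ebener Kurven*, Compositio Math. 2 (1935)
50–62, Satz I: the tangent of a simple closed plane curve turns by `±2π`. We prove the polygonal
case, which is what the lattice-model files consume (`Literature.Probability.LatticeModels`,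
the cycles of the medial turning rule): for a closed polygon `z₀ z₁ … z_{n-1} z₀` whose closed
edges are pairwise disjoint except that consecutive edges share their common vertex, the sum of
the exterior angles `arg ((z_{i+1} - z_i)/(z_i - z_{i-1})) ∈ (-π, π)` is `2π` or `-2π`
(`IsSimplePolygon.sum_extAngle_eq`).

The proof is Hopf's secant argument, verbatim for polygons:
* the closed polygon is the `n`-periodic piecewise-affine map `polygonMap z : ℝ → ℂ` (edge `i`
  parametrised by `[i, i+1]`); simplicity makes it injective modulo `n`
  (`IsSimplePolygon.exists_eq_add_of_eq`);
* the secant map `S (s, t) = P t - P s` is continuous and nowhere zero on the open convex strip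
  `U = {0 < t - s < n}`, hence has a continuous logarithm `L` there (Mathlib's
  `Complex.exists_continuousOn_eqOn_exp_comp` on a convex, hence simply connected, open set);
* after re-indexing so that `z₀` is a lowest vertex, the increments of `L` along the closed chain
  `(0,1) → (0,n-1) → (1,n) → (n-1,n) → (0,1)` in `U` sum to zero; the two legs contribute the
  same amount `log (I (z₀ - z_{n-1})) - log (-I (z₁ - z₀))` (principal branch: `P t - z₀` lies in
  the closed upper half-plane), the short side contributes the exterior angle at `z₀`, and along
  the line `t - s = 1` the secant `P t - P (t - 1)` sweeps the segment from `z_k - z_{k-1}` to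
  `z_{k+1} - z_k` over `t ∈ [k, k+1]`, contributing the exterior angle at `z_k`;
* comparing imaginary parts pins the total turning to `±2π`.

Everything here is proved; no Jordan curve theorem is used.

## Overlap with existing polygon notions (for a librarian `refactor:` item)

The tree already has three renderings of "closed polygon", none of which this leaf imports (it
sits below both consumer topics and needs an `ℝ`-parametrised, `n`-periodic map with *integer*
break points for the secant argument):
* `Literature.Probability.RandomPlanarGeometry.IsSimpleClosedPolygon l` (`PolygonalDomains.lean`,
  `List`-based: pairwise disjoint *half-open* edges) and the `1`-periodic loop
  `Literature.Probability.RandomPlanarGeometry.polygonLoop l` (`AffineInterp.lean`, which in turn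
  records the percolation copies `Literature.Probability.Percolation.affineInterp` / `closedCurve`);
  for `3 ≤ l.length` the notions agree: `IsSimplePolygon (fun i => l[(i % l.length).toNat]) l.length
  ↔ IsSimpleClosedPolygon l` (closed non-adjacent edges disjoint + adjacent closed edges meeting
  only at the vertex ⇔ half-open edges pairwise disjoint), and `polygonMap z (n t) = polygonLoop l t`;
  the bridge is to live in `RandomPlanarGeometry` (not proved here).
* Mathlib's `Polygon P n` (`Mathlib.Geometry.Polygon.Basic`: vertices `Fin n → P`, `edgeSet`,
  `HasNondegenerateEdges` = our field `ne_succ`); Mathlib has no simplicity predicate or turning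
  number for it yet.
* `extAngle z i` is by `rfl` the turning angle `Literature.Probability.LatticeModels.turning
  (z (i-1)) (z i) (z (i+1))` of `FermionicObservable.lean` (whose `winding` is the list sum of
  these); the `rfl` bridge `extAngle_eq_turning` is stated in the consumer
  `Literature/Probability/LatticeModels/MedialCycleTurning.lean`.
* `sum_range_shift_of_periodic` (shift invariance of a periodic sum, general shift `i₀`) has the
  special case `i₀ = 1` under the same name in
  `Literature.MathematicalPhysics.StatisticalMechanics` (`HaggStacking.lean`) and a general form
  `Literature.NumberTheory.LFunctions.Tao2016.sum_range_periodic_add`; a shared home (HarnessLib)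
  would serve all three. Periodicity under multiples of the period is Mathlib's
  `Function.Periodic.int_mul` (the field `IsSimplePolygon.periodic` is a `Function.Periodic`).
-/

noncomputable section

open Complex Set Filter
open scoped Real

namespace Literature.Topology.PlaneTopology

/-! ### Closed polygons as periodic piecewise-affine maps -/

/-- The closed polygon through the vertices `z i` (`i : ℤ`), edge `i` being run through at unit
speed in parameter time `[i, i + 1]`: `P t = z ⌊t⌋ + (t - ⌊t⌋) (z (⌊t⌋ + 1) - z ⌊t⌋)`. For an
`n`-periodic vertex sequence this is an `n`-periodic parametrisation of the closed polygon
`z₀ z₁ ⋯ z_{n-1} z₀`. [cite: Hopf1935, §1] -/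
def polygonMap (z : ℤ → ℂ) (t : ℝ) : ℂ :=
  z ⌊t⌋ + ((t - ⌊t⌋ : ℝ) : ℂ) * (z (⌊t⌋ + 1) - z ⌊t⌋)

/-- On the parameter interval `[k, k + 1]` the polygon runs affinely along edge `k`. [cite: Hopf1935, §1] -/
theorem polygonMap_of_mem_Icc (z : ℤ → ℂ) {k : ℤ} {t : ℝ} (ht : t ∈ Icc (k : ℝ) (k + 1)) :
    polygonMap z t = z k + ((t - k : ℝ) : ℂ) * (z (k + 1) - z k) := by
  rcases ht.2.lt_or_eq with h | h
  · have hk : ⌊t⌋ = k := Int.floor_eq_iff.2 ⟨ht.1, h⟩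
    simp [polygonMap, hk]
  · have hk : ⌊t⌋ = k + 1 := by
      rw [h]; exact_mod_cast Int.floor_intCast (k + 1)
    rw [polygonMap, hk, h]
    push_cast
    ring

/-- The polygon passes through the vertex `z k` at time `k`. [cite: Hopf1935, §1] -/
theorem polygonMap_intCast (z : ℤ → ℂ) (k : ℤ) : polygonMap z k = z k := by
  rw [polygonMap_of_mem_Icc z (k := k) (t := k) ⟨le_rfl, by linarith⟩]
  simp

/-- The polygon map is continuous (the affine pieces agree at the vertices). [cite: Hopf1935, §1] -/
theorem continuous_polygonMap (z : ℤ → ℂ) : Continuous (polygonMap z) := by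
  have hlf : LocallyFinite fun k : ℤ => Icc (k : ℝ) (k + 1) :=
    locallyFinite_Icc_of_tendsto tendsto_intCast_atTop_atTop
      (tendsto_atBot_add_const_right _ _ (tendsto_intCast_atBot_iff.2 tendsto_id))
  refine hlf.continuous ?_ (fun _ => isClosed_Icc) fun k => ?_
  · exact eq_univ_of_forall fun t => mem_iUnion.2 ⟨⌊t⌋, Int.floor_le t, (Int.lt_floor_add_one t).le⟩
  · have hc : ContinuousOn (fun t : ℝ => z k + ((t - k : ℝ) : ℂ) * (z (k + 1) - z k)) (Icc (k : ℝ) (k + 1)) := by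
      fun_prop
    exact hc.congr fun t ht => polygonMap_of_mem_Icc z ht

/-- The point of edge `k` with parameter `θ ∈ [0, 1]` lies on the closed edge. [folklore] -/
theorem add_mul_mem_segment (a b : ℂ) {θ : ℝ} (h0 : 0 ≤ θ) (h1 : θ ≤ 1) :
    a + (θ : ℂ) * (b - a) ∈ segment ℝ a b := by
  rw [segment_eq_image']
  exact ⟨θ, ⟨h0, h1⟩, by simp [Complex.real_smul]⟩

/-- The polygon at time `t` lies on the closed edge `⌊t⌋`. [cite: Hopf1935, §1] -/
theorem polygonMap_mem_segment (z : ℤ → ℂ) (t : ℝ) :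
    polygonMap z t ∈ segment ℝ (z ⌊t⌋) (z (⌊t⌋ + 1)) := by
  rw [polygonMap_of_mem_Icc z (k := ⌊t⌋) ⟨Int.floor_le t, (Int.lt_floor_add_one t).le⟩]
  exact add_mul_mem_segment _ _ (sub_nonneg.2 (Int.floor_le t)) (by linarith [Int.lt_floor_add_one t])

/-! ### Simple closed polygons -/

/-- **A simple closed polygon** with `n ≥ 3` vertices, given by an `n`-periodic vertex sequence
`z : ℤ → ℂ`: consecutive vertices are distinct, non-adjacent closed edges are disjoint, and
adjacent closed edges meet only at their common vertex (so there are no U-turns). This is the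
hypothesis "einfach geschlossen" of Hopf's Satz I, for polygons. It mirrors the `List`-based
`Literature.Probability.RandomPlanarGeometry.IsSimpleClosedPolygon` (pairwise disjoint half-open
edges; equivalent for `n ≥ 3`, see the module docstring) in the `ℤ`-periodic format needed for
the secant argument; `ne_succ` is Mathlib's `Polygon.HasNondegenerateEdges`. [cite: Hopf1935, Satz I] -/
structure IsSimplePolygon (z : ℤ → ℂ) (n : ℕ) : Prop where
  /-- at least three vertices -/
  three_le : 3 ≤ n
  /-- the vertex sequence is `n`-periodic -/
  periodic : Function.Periodic z n
  /-- consecutive vertices are distinct -/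
  ne_succ : ∀ i, z (i + 1) ≠ z i
  /-- non-adjacent closed edges are disjoint -/
  disjoint : ∀ i j : ℤ, (∀ m : ℤ, j ≠ i + m * n) → (∀ m : ℤ, j ≠ i + 1 + m * n) →
    (∀ m : ℤ, j ≠ i - 1 + m * n) →
    Disjoint (segment ℝ (z i) (z (i + 1))) (segment ℝ (z j) (z (j + 1)))
  /-- adjacent closed edges meet only at the common vertex -/
  adjacent : ∀ i, segment ℝ (z (i - 1)) (z i) ∩ segment ℝ (z i) (z (i + 1)) ⊆ {z i}

namespace IsSimplePolygon

variable {z : ℤ → ℂ} {n : ℕ}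

/-- The number of vertices is positive. [folklore] -/
theorem pos (h : IsSimplePolygon z n) : 0 < n := by linarith [h.three_le]

/-- The number of vertices, as a real number, exceeds `2`. [folklore] -/
theorem two_lt (h : IsSimplePolygon z n) : (2 : ℝ) < n := by exact_mod_cast h.three_le

/-- Shifting the indices of a simple closed polygon gives a simple closed polygon. [folklore] -/
theorem shift (h : IsSimplePolygon z n) (i₀ : ℤ) : IsSimplePolygon (fun i => z (i + i₀)) n where
  three_le := h.three_le
  periodic i := by simp only; rw [show i + n + i₀ = i + i₀ + n by ring]; exact h.periodic _
  ne_succ i := by rw [show i + 1 + i₀ = i + i₀ + 1 by ring]; exact h.ne_succ _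
  disjoint i j h0 h1 h2 := by
    rw [show i + 1 + i₀ = i + i₀ + 1 by ring, show j + 1 + i₀ = j + i₀ + 1 by ring]
    refine h.disjoint (i + i₀) (j + i₀) (fun m hm => h0 m (by linarith)) (fun m hm => h1 m (by linarith))
      fun m hm => h2 m (by linarith)
  adjacent i := by
    rw [show i - 1 + i₀ = i + i₀ - 1 by ring, show i + 1 + i₀ = i + i₀ + 1 by ring]
    exact h.adjacent _

/-- **Injectivity modulo the period.** Two parameters with the same image differ by a multiple
of `n`. [cite: Hopf1935, Satz I] -/
theorem exists_eq_add_of_eq (h : IsSimplePolygon z n) {s t : ℝ}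
    (hst : polygonMap z s = polygonMap z t) : ∃ m : ℤ, t = s + m * n := by
  have hn0 : (n : ℤ) ≠ 0 := by exact_mod_cast h.pos.ne'
  set i := ⌊s⌋ with hi
  set j := ⌊t⌋ with hj
  set r := (j - i) % n with hr
  set q := (j - i) / n with hq
  have hjq : j = i + r + q * n := by
    have := Int.emod_add_mul_ediv (j - i) n
    rw [← hr, ← hq] at this
    linarith
  have hrmod : r % n = r := Int.emod_eq_of_lt (Int.emod_nonneg _ hn0) (Int.emod_lt_of_pos _ (by exact_mod_cast h.pos))
  have hr0 : 0 ≤ r := Int.emod_nonneg _ hn0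
  have hrn : r < n := Int.emod_lt_of_pos _ (by exact_mod_cast h.pos)
  have hs : s ∈ Icc (i : ℝ) (i + 1) := ⟨Int.floor_le s, (Int.lt_floor_add_one s).le⟩
  have ht : t ∈ Icc (j : ℝ) (j + 1) := ⟨Int.floor_le t, (Int.lt_floor_add_one t).le⟩
  have hs1 : s < i + 1 := Int.lt_floor_add_one s
  have ht1 : t < j + 1 := Int.lt_floor_add_one t
  have hPs := polygonMap_of_mem_Icc z hs
  have hPt := polygonMap_of_mem_Icc z ht
  have hzj : z j = z (i + r) := by rw [hjq]; exact h.periodic.int_mul _ _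
  have hzj1 : z (j + 1) = z (i + r + 1) := by
    rw [hjq, show i + r + q * n + 1 = i + r + 1 + q * n by ring]; exact h.periodic.int_mul _ _
  have hmems : polygonMap z s ∈ segment ℝ (z i) (z (i + 1)) := polygonMap_mem_segment z s
  have hmemt : polygonMap z t ∈ segment ℝ (z (i + r)) (z (i + r + 1)) := by
    rw [← hzj, ← hzj1]; exact polygonMap_mem_segment z t
  by_cases h0 : r = 0
  · -- same edge
    rw [h0, add_zero] at hzj hzj1
    refine ⟨q, ?_⟩
    rw [hPs, hPt, hzj, hzj1] at hst
    have hne : z (i + 1) - z i ≠ 0 := sub_ne_zero.2 (h.ne_succ i)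
    have := mul_right_cancel₀ hne (add_left_cancel hst)
    have hre := congrArg Complex.re this
    simp only [Complex.ofReal_re] at hre
    have hjq' : (j : ℝ) = i + q * n := by rw [hjq, h0]; push_cast; ring
    linarith
  by_cases h1 : r = 1
  · -- the next edge: the common point would be the vertex `z (i+1)`, not attained on `[i, i+1)`
    exfalso
    rw [h1] at hmemt
    have hx : polygonMap z s ∈ ({z (i + 1)} : Set ℂ) := by
      refine h.adjacent (i + 1) ⟨?_, ?_⟩
      · rw [add_sub_cancel_right]; exact hmems
      · rw [hst]; exact hmemt
    rw [mem_singleton_iff, hPs] at hx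
    have hne : z (i + 1) - z i ≠ 0 := sub_ne_zero.2 (h.ne_succ i)
    have : ((s - i : ℝ) : ℂ) = 1 := by
      apply mul_right_cancel₀ hne
      rw [one_mul]; exact (add_left_cancel (hx.trans (by ring : z (i + 1) = z i + (z (i + 1) - z i))))
    have hre := congrArg Complex.re this
    simp only [Complex.ofReal_re, Complex.one_re] at hre
    linarith
  by_cases h2 : r = n - 1
  · -- the previous edge: the common point would be `z i = z (j+1)`, not attained on `[j, j+1)`
    exfalso
    have hzj' : z j = z (i - 1) := by
      rw [hzj, h2, show i + (n - 1 : ℤ) = i - 1 + n by ring]; exact h.periodic _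
    have hzj1' : z (j + 1) = z i := by
      rw [hzj1, h2, show i + (n - 1 : ℤ) + 1 = i + n by ring]; exact h.periodic _
    have hmemt' : polygonMap z t ∈ segment ℝ (z (i - 1)) (z i) := by
      rw [← hzj', ← hzj1']; exact polygonMap_mem_segment z t
    have hx : polygonMap z t ∈ ({z i} : Set ℂ) := h.adjacent i ⟨hmemt', by rw [← hst]; exact hmems⟩
    rw [mem_singleton_iff, hPt, hzj', hzj1'] at hx
    have hne : z i - z (i - 1) ≠ 0 := sub_ne_zero.2 (by
      have := h.ne_succ (i - 1); rwa [sub_add_cancel] at this)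
    have : ((t - j : ℝ) : ℂ) = 1 := by
      apply mul_right_cancel₀ hne
      rw [one_mul]; exact (add_left_cancel (hx.trans (by ring : z i = z (i - 1) + (z i - z (i - 1)))))
    have hre := congrArg Complex.re this
    simp only [Complex.ofReal_re, Complex.one_re] at hre
    linarith
  · -- non-adjacent edges are disjoint
    exfalso
    have hd := h.disjoint i (i + r) ?_ ?_ ?_
    · exact Set.disjoint_left.1 hd hmems (hst ▸ hmemt)
    · intro m hm
      have hrm : r = m * n := by linarith
      have : r % n = 0 := by rw [hrm, Int.mul_emod_left]
      exact h0 (hrmod.symm.trans this)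
    · intro m hm
      have hrm : r = 1 + m * n := by linarith
      have h1n : (1 : ℤ) % n = 1 := Int.emod_eq_of_lt (by norm_num) (by have := h.three_le; omega)
      have : r % n = 1 := by rw [hrm, Int.add_mul_emod_self_right, h1n]
      exact h1 (hrmod.symm.trans this)
    · intro m hm
      have hrm : r = -1 + m * n := by linarith
      have hneg : (-1 : ℤ) % n = n - 1 := by
        have h3 := h.three_le
        rw [← Int.add_emod_right (-1) n]
        exact Int.emod_eq_of_lt (by omega) (by omega)
      have : r % n = n - 1 := by rw [hrm, Int.add_mul_emod_self_right, hneg]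
      exact h2 (hrmod.symm.trans this)

/-- Distinct parameters less than a period apart have distinct images. [cite: Hopf1935, Satz I] -/
theorem polygonMap_ne (h : IsSimplePolygon z n) {s t : ℝ} (h0 : 0 < t - s) (h1 : t - s < n) :
    polygonMap z t ≠ polygonMap z s := by
  intro hst
  obtain ⟨m, hm⟩ := h.exists_eq_add_of_eq hst.symm
  have hnpos : (0 : ℝ) < n := by exact_mod_cast h.pos
  rcases le_or_gt m 0 with hm0 | hm0
  · have : (m : ℝ) * n ≤ 0 := mul_nonpos_of_nonpos_of_nonneg (by exact_mod_cast hm0) hnpos.le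
    linarith
  · have hm1 : (1 : ℝ) ≤ m := by exact_mod_cast hm0
    have : (n : ℝ) ≤ m * n := by nlinarith
    linarith

/-- **No U-turns**: the ratio of consecutive edge vectors is not a non-positive real, i.e. lies
in the slit plane (otherwise the two edges would overlap near the common vertex).
[cite: Hopf1935, Satz I] -/
theorem div_mem_slitPlane (h : IsSimplePolygon z n) (i : ℤ) :
    (z (i + 1) - z i) / (z i - z (i - 1)) ∈ slitPlane := by
  set a := z i - z (i - 1) with ha
  set b := z (i + 1) - z i with hb
  have ha0 : a ≠ 0 := sub_ne_zero.2 (by have := h.ne_succ (i - 1); rwa [sub_add_cancel] at this)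
  have hb0 : b ≠ 0 := sub_ne_zero.2 (h.ne_succ i)
  by_contra hw
  rw [mem_slitPlane_iff, not_or, not_lt, not_not] at hw
  set w := b / a with hw'
  have hbw : b = w * a := by rw [hw', div_mul_cancel₀ _ ha0]
  have hw0 : w ≠ 0 := fun h0 => hb0 (by rw [hbw, h0, zero_mul])
  -- `w = -c` with `c > 0`
  set c : ℝ := -w.re with hc
  have hwc : w = -(c : ℂ) := by
    apply Complex.ext <;> simp [hc, hw.2]
  have hcpos : 0 < c := by
    rcases hw.1.lt_or_eq with hlt | heq
    · rw [hc]; linarith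
    · exfalso; apply hw0; apply Complex.ext <;> simp [heq, hw.2]
  -- the point `z i - ρ a = z i + (ρ / c) b`, `ρ = min 1 c`, lies on both edges and is not `z i`
  set ρ : ℝ := min 1 c with hρ
  have hρpos : 0 < ρ := lt_min one_pos hcpos
  have hρ1 : ρ ≤ 1 := min_le_left _ _
  have hρc : ρ ≤ c := min_le_right _ _
  have hp1 : z i - (ρ : ℂ) * a ∈ segment ℝ (z (i - 1)) (z i) := by
    have : z i - (ρ : ℂ) * a = z (i - 1) + ((1 - ρ : ℝ) : ℂ) * (z i - z (i - 1)) := by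
      rw [ha]; push_cast; ring
    rw [this]
    exact add_mul_mem_segment _ _ (by linarith) (by linarith)
  have hp2 : z i - (ρ : ℂ) * a ∈ segment ℝ (z i) (z (i + 1)) := by
    have : z i - (ρ : ℂ) * a = z i + ((ρ / c : ℝ) : ℂ) * (z (i + 1) - z i) := by
      rw [← hb, hbw, hwc]
      have hc0 : (c : ℂ) ≠ 0 := by exact_mod_cast hcpos.ne'
      push_cast
      field_simp
      ring
    rw [this]
    exact add_mul_mem_segment _ _ (div_nonneg hρpos.le hcpos.le) ((div_le_one hcpos).2 hρc)
  have hx := h.adjacent i ⟨hp1, hp2⟩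
  rw [mem_singleton_iff, sub_eq_self, mul_eq_zero] at hx
  rcases hx with hx | hx
  · exact hρpos.ne' (by exact_mod_cast hx)
  · exact ha0 hx

/-- Two integers with the same residue differ by a multiple of the modulus. [folklore] -/
theorem exists_eq_add_mul_of_emod_eq {a b n : ℤ} (h : a % n = b % n) : ∃ m : ℤ, a = b + m * n := by
  have h0 : (a - b) % n = 0 := Int.emod_eq_emod_iff_emod_sub_eq_zero.1 h
  obtain ⟨c, hc⟩ := Int.dvd_of_emod_eq_zero h0
  exact ⟨c, by linear_combination hc⟩

/-- **Constructor from one period.** It suffices to check the three conditions for indices in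
`[0, n)`, adjacency being read modulo `n`. [folklore] -/
theorem of_Ico (h3 : 3 ≤ n) (hper : ∀ i, z (i + n) = z i)
    (hne : ∀ i : ℤ, 0 ≤ i → i < n → z (i + 1) ≠ z i)
    (hdisj : ∀ i j : ℤ, 0 ≤ i → i < n → 0 ≤ j → j < n → j ≠ i → j ≠ (i + 1) % n → i ≠ (j + 1) % n →
      Disjoint (segment ℝ (z i) (z (i + 1))) (segment ℝ (z j) (z (j + 1))))
    (hadj : ∀ i : ℤ, 0 ≤ i → i < n → segment ℝ (z (i - 1)) (z i) ∩ segment ℝ (z i) (z (i + 1)) ⊆ {z i}) :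
    IsSimplePolygon z n := by
  have hn0 : (n : ℤ) ≠ 0 := by omega
  have hnpos : (0 : ℤ) < n := by omega
  -- reduction of an index to `[0, n)`
  have red : ∀ i : ℤ, ∃ r : ℤ, 0 ≤ r ∧ r < n ∧ r % n = i % n ∧ z i = z r ∧ z (i + 1) = z (r + 1) ∧ z (i - 1) = z (r - 1) := by
    intro i
    refine ⟨i % n, Int.emod_nonneg _ hn0, Int.emod_lt_of_pos _ hnpos, Int.emod_emod_of_dvd _ (dvd_refl _), ?_, ?_, ?_⟩
    · have := Int.emod_add_mul_ediv i n
      conv_lhs => rw [← this, mul_comm]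
      exact Function.Periodic.int_mul hper _ _
    · have := Int.emod_add_mul_ediv i n
      conv_lhs => rw [← this, mul_comm, show i % n + i / n * n + 1 = i % n + 1 + i / n * n by ring]
      exact Function.Periodic.int_mul hper _ _
    · have := Int.emod_add_mul_ediv i n
      conv_lhs => rw [← this, mul_comm, show i % n + i / n * n - 1 = i % n - 1 + i / n * n by ring]
      exact Function.Periodic.int_mul hper _ _
  refine ⟨h3, hper, fun i => ?_, fun i j h0 h1 h2 => ?_, fun i => ?_⟩
  · obtain ⟨r, hr0, hrn, -, e0, e1, -⟩ := red i
    rw [e0, e1]; exact hne r hr0 hrn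
  · obtain ⟨r, hr0, hrn, hri, e0, e1, -⟩ := red i
    obtain ⟨r', hr0', hrn', hrj, e0', e1', -⟩ := red j
    rw [e0, e1, e0', e1']
    have hrr : r % n = r := Int.emod_eq_of_lt hr0 hrn
    have hrr' : r' % n = r' := Int.emod_eq_of_lt hr0' hrn'
    refine hdisj r r' hr0 hrn hr0' hrn' ?_ ?_ ?_
    · intro heq
      have : j % n = i % n := by rw [← hrj, hrr', heq, ← hri, hrr]
      obtain ⟨m, hm⟩ := exists_eq_add_mul_of_emod_eq this
      exact h0 m hm
    · intro heq
      have : j % n = (i + 1) % n := by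
        rw [← hrj, heq, Int.add_emod, hri, ← Int.add_emod, Int.emod_emod]
      obtain ⟨m, hm⟩ := exists_eq_add_mul_of_emod_eq this
      exact h1 m hm
    · intro heq
      have : i % n = (j + 1) % n := by
        rw [← hri, heq, Int.add_emod, hrj, ← Int.add_emod, Int.emod_emod]
      obtain ⟨m, hm⟩ := exists_eq_add_mul_of_emod_eq this
      exact h2 (-m) (by linarith)
  · obtain ⟨r, hr0, hrn, -, e0, e1, e2⟩ := red i
    rw [e0, e1, e2]; exact hadj r hr0 hrn

/-- The exterior angle is not `π`. [cite: Hopf1935, Satz I] -/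
theorem arg_div_ne_pi (h : IsSimplePolygon z n) (i : ℤ) :
    arg ((z (i + 1) - z i) / (z i - z (i - 1))) ≠ π :=
  slitPlane_arg_ne_pi (h.div_mem_slitPlane i)

end IsSimplePolygon

/-- The **exterior angle** of the polygon at the vertex `z i`: the signed angle in `(-π, π]`
from the incoming edge vector `z i - z (i-1)` to the outgoing one `z (i+1) - z i`
(for a simple polygon it lies in `(-π, π)`, `IsSimplePolygon.abs_extAngle_lt_pi`). By `rfl` this
is `Literature.Probability.LatticeModels.turning (z (i-1)) (z i) (z (i+1))` of
`FermionicObservable.lean` (stated there as `extAngle_eq_turning` in `MedialCycleTurning.lean`).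
[cite: Hopf1935, §1] -/
def extAngle (z : ℤ → ℂ) (i : ℤ) : ℝ := arg ((z (i + 1) - z i) / (z i - z (i - 1)))

/-- The exterior angles of a simple closed polygon are not `π`. [cite: Hopf1935, Satz I] -/
theorem IsSimplePolygon.extAngle_ne_pi {z : ℤ → ℂ} {n : ℕ} (h : IsSimplePolygon z n) (i : ℤ) :
    extAngle z i ≠ π :=
  h.arg_div_ne_pi i

/-- The exterior angles of a simple closed polygon lie in `(-π, π)`. [cite: Hopf1935, Satz I] -/
theorem IsSimplePolygon.abs_extAngle_lt_pi {z : ℤ → ℂ} {n : ℕ} (h : IsSimplePolygon z n) (i : ℤ) :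
    |extAngle z i| < π :=
  abs_lt.2 ⟨neg_pi_lt_arg _, lt_of_le_of_ne (arg_le_pi _) (h.extAngle_ne_pi i)⟩

/-! ### The secant map on the strip `0 < t - s < n` -/

/-- Hopf's secant map `S (s, t) = P t - P s` of the closed polygon. [cite: Hopf1935, §2] -/
def secantMap (z : ℤ → ℂ) (p : ℝ × ℝ) : ℂ := polygonMap z p.2 - polygonMap z p.1

/-- The open strip `0 < t - s < n` of parameter pairs less than one period apart (Hopf's
triangle, unrolled by periodicity). [cite: Hopf1935, §2] -/
def secantStrip (n : ℕ) : Set (ℝ × ℝ) := {p | 0 < p.2 - p.1 ∧ p.2 - p.1 < n}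

/-- The secant map is continuous. [cite: Hopf1935, §2] -/
theorem continuous_secantMap (z : ℤ → ℂ) : Continuous (secantMap z) :=
  ((continuous_polygonMap z).comp continuous_snd).sub ((continuous_polygonMap z).comp continuous_fst)

/-- The strip is open. [folklore] -/
theorem isOpen_secantStrip (n : ℕ) : IsOpen (secantStrip n) := by
  have hc : Continuous fun p : ℝ × ℝ => p.2 - p.1 := by fun_prop
  exact (isOpen_Ioo.preimage hc : IsOpen ((fun p : ℝ × ℝ => p.2 - p.1) ⁻¹' Ioo 0 (n : ℝ)))

/-- The strip is convex. [folklore] -/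
theorem convex_secantStrip (n : ℕ) : Convex ℝ (secantStrip n) := by
  intro p hp q hq a b ha hb hab
  obtain ⟨hp1, hp2⟩ := hp
  obtain ⟨hq1, hq2⟩ := hq
  simp only [secantStrip, mem_setOf_eq, Prod.snd_add, Prod.fst_add, Prod.smul_snd, Prod.smul_fst,
    smul_eq_mul]
  have e : a * p.2 + b * q.2 - (a * p.1 + b * q.1) = a * (p.2 - p.1) + b * (q.2 - q.1) := by ring
  rw [e]
  rcases ha.eq_or_lt with rfl | ha'
  · rw [zero_add] at hab
    rw [hab]
    constructor <;> linarith
  · constructor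
    · exact add_pos_of_pos_of_nonneg (mul_pos ha' hp1) (mul_nonneg hb hq1.le)
    · calc a * (p.2 - p.1) + b * (q.2 - q.1) < a * n + b * n :=
            add_lt_add_of_lt_of_le (mul_lt_mul_of_pos_left hp2 ha') (mul_le_mul_of_nonneg_left hq2.le hb)
        _ = n := by rw [← add_mul, hab, one_mul]

/-- **The secant map has a continuous logarithm on the strip**: it is continuous and nowhere zero
there (injectivity modulo the period), and the strip is convex and open, hence simply connected.
[cite: Hopf1935, §2] -/
theorem IsSimplePolygon.hasLogOn_secantMap {z : ℤ → ℂ} {n : ℕ} (h : IsSimplePolygon z n) :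
    HasLogOn (secantMap z) (secantStrip n) := by
  have h1n : (1 : ℝ) < n := by exact_mod_cast (by linarith [h.three_le] : 1 < n)
  have hne : (secantStrip n).Nonempty :=
    ⟨(0, 1), show 0 < (1 : ℝ) - 0 ∧ (1 : ℝ) - 0 < n from ⟨by norm_num, by linarith⟩⟩
  have hsc : IsSimplyConnected (secantStrip n) := by
    have := (convex_secantStrip n).contractibleSpace hne
    show SimplyConnectedSpace (secantStrip n)
    infer_instance
  have h0 : (0 : ℂ) ∉ secantMap z '' secantStrip n := by
    rintro ⟨p, hp, hp0⟩
    exact h.polygonMap_ne hp.1 hp.2 (sub_eq_zero.1 hp0)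
  obtain ⟨L, hL, hLe⟩ := Complex.exists_continuousOn_eqOn_exp_comp hsc (isOpen_secantStrip n)
    (continuous_secantMap z).continuousOn h0
  exact ⟨L, hL, fun p hp => hLe hp⟩

/-! ### Increments of the logarithm: elementary evaluations -/

/-- Multiplying by a nonzero constant does not change the increment of the logarithm. [folklore] -/
theorem logInc_const_mul {f : ℝ → ℂ} (hf : HasLogOn f (Icc 0 1)) {c : ℂ} (hc : c ≠ 0) :
    logInc (fun t => c * f t) = logInc f := by
  rw [logInc_mul (hasLogOn_const hc _) hf, logInc_const, zero_add]

/-- A continuous function with values in the slit plane on `[0, 1]` has a logarithm there (the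
principal one). [folklore] -/
theorem hasLogOn_of_mem_slitPlane {f : ℝ → ℂ} (hf : ContinuousOn f (Icc 0 1))
    (h : ∀ t ∈ Icc (0 : ℝ) 1, f t ∈ slitPlane) : HasLogOn f (Icc 0 1) :=
  ⟨fun t => log (f t), hf.clog h, fun t ht => exp_log (slitPlane_ne_zero (h t ht))⟩

/-- **The segment lemma.** Along the straight segment from `a` to `b` (not passing through `0`
on the far side: `b / a` in the slit plane) the logarithm increases by the principal value
`log (b / a)`; in particular the argument increases by the signed angle `arg (b / a) ∈ (-π, π)`.
[folklore] -/
theorem logInc_segment {a b : ℂ} (ha : a ≠ 0) (h : b / a ∈ slitPlane) :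
    logInc (fun v : ℝ => (1 - (v : ℂ)) * a + (v : ℂ) * b) = log (b / a) := by
  set g : ℝ → ℂ := fun v => (1 - (v : ℂ)) + (v : ℂ) * (b / a) with hg
  have hfg : (fun v : ℝ => (1 - (v : ℂ)) * a + (v : ℂ) * b) = fun v => a * g v := by
    funext v; rw [hg]; field_simp
  have hgc : ContinuousOn g (Icc 0 1) := by rw [hg]; fun_prop
  have hgmem : ∀ v ∈ Icc (0 : ℝ) 1, g v ∈ slitPlane := fun v hv => by
    have := starConvex_one_slitPlane h (sub_nonneg.2 hv.2) hv.1 (by ring)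
    simpa [hg, Complex.real_smul, smul_eq_mul] using this
  rw [hfg, logInc_const_mul (hasLogOn_of_mem_slitPlane hgc hgmem) ha, logInc_eq_log_sub_log hgc hgmem]
  simp [hg]

/-- Increment of the logarithm of `f ∘ φ` in terms of a logarithm `l` of `f` on a set `T`
containing `φ [0, 1]`. [folklore] -/
theorem logInc_comp_of_log {X : Type*} [TopologicalSpace X] {F L : X → ℂ} {T : Set X}
    (hL : ContinuousOn L T) (hLe : ∀ x ∈ T, exp (L x) = F x) {γ : ℝ → X}
    (hγ : ContinuousOn γ (Icc 0 1)) (hγT : MapsTo γ (Icc 0 1) T) :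
    logInc (F ∘ γ) = L (γ 1) - L (γ 0) :=
  logInc_eq (l := L ∘ γ) (hL.comp hγ hγT) fun _ ht => hLe _ (hγT ht)


/-- `polygonMap_of_mem_Icc` with the left endpoint given as a real number. [folklore] -/
theorem polygonMap_of_mem_Icc' (z : ℤ → ℂ) {k : ℤ} {c t : ℝ} (hc : (k : ℝ) = c)
    (ht : t ∈ Icc c (c + 1)) : polygonMap z t = z k + ((t - c : ℝ) : ℂ) * (z (k + 1) - z k) := by
  subst hc; exact polygonMap_of_mem_Icc z ht

/-- `polygonMap_intCast` with the time given as a real number. [folklore] -/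
theorem polygonMap_eq_vertex (z : ℤ → ℂ) {k : ℤ} {c : ℝ} (hc : (k : ℝ) = c) : polygonMap z c = z k := by
  subst hc; exact polygonMap_intCast z k

/-! ### Hopf's chain: the four pieces and the increments along them -/

/-- Leg `A` of Hopf's chain: `u ↦ (0, 1 + u (n - 2))`, from `(0, 1)` to `(0, n - 1)`. [cite: Hopf1935, §2] -/
def hopfA (n : ℕ) (u : ℝ) : ℝ × ℝ := (0, 1 + u * (n - 2))

/-- Side `B` of Hopf's chain: `u ↦ (u, n - 1 + u)`, from `(0, n - 1)` to `(1, n)`. [cite: Hopf1935, §2] -/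
def hopfB (n : ℕ) (u : ℝ) : ℝ × ℝ := (u, n - 1 + u)

/-- Leg `C` of Hopf's chain: `u ↦ (1 + u (n - 2), n)`, from `(1, n)` to `(n - 1, n)`. [cite: Hopf1935, §2] -/
def hopfC (n : ℕ) (u : ℝ) : ℝ × ℝ := (1 + u * (n - 2), n)

/-- Side `D` of Hopf's chain: back along the line `t - s = 1`, from `(n - 1, n)` to `(0, 1)`.
[cite: Hopf1935, §2] -/
def hopfD (n : ℕ) (u : ℝ) : ℝ × ℝ := ((n - 1) * (1 - u), 1 + (n - 1) * (1 - u))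

/-- The secant along the line `t - s = 1`, run forward: `u ↦ S ((n-1) u, 1 + (n-1) u)`; on the
`j`-th of `n - 1` equal sub-intervals it sweeps the segment from `z (j+1) - z j` to
`z (j+2) - z (j+1)` (`diagSecant_window`). [cite: Hopf1935, §2] -/
def diagSecant (z : ℤ → ℂ) (n : ℕ) (u : ℝ) : ℂ := secantMap z ((n - 1) * u, 1 + (n - 1) * u)

section Values

variable {z : ℤ → ℂ} {n : ℕ}

/-- With `z 0` a lowest vertex, the whole polygon lies in the closed upper half-plane through
`z 0`. [cite: Hopf1935, §2] -/
theorem im_le_im_polygonMap (hlow : ∀ i, (z 0).im ≤ (z i).im) (t : ℝ) :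
    (z 0).im ≤ (polygonMap z t).im := by
  rw [polygonMap_of_mem_Icc z (k := ⌊t⌋) ⟨Int.floor_le t, (Int.lt_floor_add_one t).le⟩]
  have h1 := hlow ⌊t⌋
  have h2 := hlow (⌊t⌋ + 1)
  have hθ0 : 0 ≤ t - ⌊t⌋ := sub_nonneg.2 (Int.floor_le t)
  have hθ1 : t - ⌊t⌋ ≤ 1 := by linarith [Int.lt_floor_add_one t]
  simp only [add_im, mul_im, ofReal_re, ofReal_im, zero_mul, add_zero, sub_im]
  nlinarith [mul_nonneg (sub_nonneg.2 hθ1) (sub_nonneg.2 h1), mul_nonneg hθ0 (sub_nonneg.2 h2)]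

/-- Hence `-I (P t - z 0)` lies in the slit plane whenever `P t ≠ z 0`. [cite: Hopf1935, §2] -/
theorem negI_mul_mem_slitPlane (hlow : ∀ i, (z 0).im ≤ (z i).im) {t : ℝ} (ht : polygonMap z t ≠ z 0) :
    -I * (polygonMap z t - z 0) ∈ slitPlane := by
  rw [mem_slitPlane_iff]
  have hre : (-I * (polygonMap z t - z 0)).re = (polygonMap z t).im - (z 0).im := by simp
  have him : (-I * (polygonMap z t - z 0)).im = -((polygonMap z t).re - (z 0).re) := by simp
  rw [hre, him]
  rcases (sub_nonneg.2 (im_le_im_polygonMap hlow t)).lt_or_eq with hlt | heq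
  · exact Or.inl hlt
  · right
    intro h0
    apply ht
    apply Complex.ext <;> linarith

/-- **Increment along leg `A`**: the secant `P t - z 0`, `t ∈ [1, n-1]`, stays in the closed upper
half-plane, so its logarithm increases by the principal amount
`log (I (z 0 - z (n-1))) - log (-I (z 1 - z 0))`. [cite: Hopf1935, §2] -/
theorem logInc_hopfA (h : IsSimplePolygon z n) (hlow : ∀ i, (z 0).im ≤ (z i).im) :
    logInc (secantMap z ∘ hopfA n) = log (I * (z 0 - z (n - 1))) - log (-I * (z 1 - z 0)) := by
  set G : ℝ → ℂ := fun u => -I * (polygonMap z (1 + u * (n - 2)) - z 0) with hG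
  have hP0 : polygonMap z 0 = z 0 := polygonMap_eq_vertex z (k := 0) (by simp)
  have hfg : secantMap z ∘ hopfA n = fun u => I * G u := by
    funext u
    simp only [Function.comp_apply, secantMap, hopfA, hG, hP0]
    rw [← mul_assoc, mul_neg, I_mul_I, neg_neg, one_mul]
  have hmem : ∀ u ∈ Icc (0 : ℝ) 1, G u ∈ slitPlane := fun u hu => by
    refine negI_mul_mem_slitPlane hlow fun heq => ?_
    refine h.polygonMap_ne (s := 0) (t := 1 + u * (n - 2)) ?_ ?_ (heq.trans hP0.symm)
    · nlinarith [hu.1, h.two_lt]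
    · nlinarith [hu.2, h.two_lt]
  have hGc : ContinuousOn G (Icc 0 1) := by
    rw [hG]
    have := continuous_polygonMap z
    fun_prop
  rw [hfg, logInc_const_mul (hasLogOn_of_mem_slitPlane hGc hmem) I_ne_zero, logInc_eq_log_sub_log hGc hmem]
  have hG0 : G 0 = -I * (z 1 - z 0) := by
    simp only [hG, zero_mul, add_zero]
    rw [polygonMap_eq_vertex z (k := 1) (by simp)]
  have hG1 : G 1 = I * (z 0 - z (n - 1)) := by
    simp only [hG, one_mul]
    rw [show (1 : ℝ) + (n - 2) = n - 1 by ring, polygonMap_eq_vertex z (k := n - 1) (by push_cast; ring)]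
    ring
  rw [hG0, hG1]

/-- **Increment along leg `C`**: the secant `z 0 - P s`, `s ∈ [1, n-1]`, is the negative of the
one along leg `A`, so the increment is the same. [cite: Hopf1935, §2] -/
theorem logInc_hopfC (h : IsSimplePolygon z n) (hlow : ∀ i, (z 0).im ≤ (z i).im) :
    logInc (secantMap z ∘ hopfC n) = log (I * (z 0 - z (n - 1))) - log (-I * (z 1 - z 0)) := by
  have hPn : polygonMap z n = z 0 := by
    rw [polygonMap_eq_vertex z (k := n) (by simp)]
    have := h.periodic 0; rwa [zero_add] at this
  have hP0 : polygonMap z 0 = z 0 := polygonMap_eq_vertex z (k := 0) (by simp)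
  have hfg : secantMap z ∘ hopfC n = fun u => (-1 : ℂ) * (secantMap z ∘ hopfA n) u := by
    funext u
    simp only [Function.comp_apply, secantMap, hopfA, hopfC, hP0, hPn]
    ring
  have hA : HasLogOn (secantMap z ∘ hopfA n) (Icc 0 1) := by
    refine hasLogOn_Icc ?_ fun u hu => ?_
    · have := continuous_polygonMap z
      show ContinuousOn (fun u => secantMap z (hopfA n u)) (Icc 0 1)
      simp only [secantMap, hopfA]
      fun_prop
    · show polygonMap z (1 + u * (n - 2)) - polygonMap z 0 ≠ 0
      refine sub_ne_zero.2 (h.polygonMap_ne (s := 0) (t := 1 + u * (n - 2)) ?_ ?_)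
      · nlinarith [hu.1, h.two_lt]
      · nlinarith [hu.2, h.two_lt]
  rw [hfg, logInc_const_mul hA (by norm_num), logInc_hopfA h hlow]

/-- The segment function has a logarithm on `[0, 1]` (hypotheses of `logInc_segment`). [folklore] -/
theorem hasLogOn_segment {a b : ℂ} (ha : a ≠ 0) (h : b / a ∈ slitPlane) :
    HasLogOn (fun v : ℝ => (1 - (v : ℂ)) * a + (v : ℂ) * b) (Icc 0 1) := by
  have hfg : (fun v : ℝ => (1 - (v : ℂ)) * a + (v : ℂ) * b) = fun v : ℝ => a * ((1 - (v : ℂ)) + (v : ℂ) * (b / a)) := by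
    funext v; field_simp
  rw [hfg]
  refine (hasLogOn_const ha _).mul (hasLogOn_of_mem_slitPlane (by fun_prop) fun v hv => ?_)
  have := starConvex_one_slitPlane h (sub_nonneg.2 hv.2) hv.1 (by ring)
  simpa [Complex.real_smul, smul_eq_mul] using this

/-- The last vertex before `z 0` is `z (n - 1) = z (-1)`. [folklore] -/
theorem IsSimplePolygon.vertex_neg_one (h : IsSimplePolygon z n) : z (-1) = z (n - 1) := by
  have := h.periodic (-1); rw [show (-1 : ℤ) + n = n - 1 by ring] at this; exact this.symm

/-- **Increment along side `B`**: the secant from `(0, n-1)` to `(1, n)` runs along the segment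
from `-(z 0 - z (n-1))` to `-(z 1 - z 0)`, so the logarithm increases by the exterior angle at
`z 0` (with its modulus part): `log ((z 1 - z 0) / (z 0 - z (n-1)))`. [cite: Hopf1935, §2] -/
theorem logInc_hopfB (h : IsSimplePolygon z n) :
    logInc (secantMap z ∘ hopfB n) = log ((z 1 - z 0) / (z 0 - z (n - 1))) := by
  set a := z 0 - z (n - 1) with ha
  set b := z 1 - z 0 with hb
  have ha0 : a ≠ 0 := by
    rw [ha, ← h.vertex_neg_one, sub_ne_zero]
    have := h.ne_succ (-1); rwa [show (-1 : ℤ) + 1 = 0 by ring] at this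
  have hba : b / a ∈ slitPlane := by
    have := h.div_mem_slitPlane 0
    rwa [zero_add, zero_sub, h.vertex_neg_one] at this
  have hfg : EqOn (secantMap z ∘ hopfB n) (fun u => (-1 : ℂ) * ((1 - (u : ℂ)) * a + (u : ℂ) * b)) (Icc 0 1) := by
    intro u hu
    simp only [Function.comp_apply, secantMap, hopfB]
    rw [polygonMap_of_mem_Icc' z (k := n - 1) (c := n - 1) (by push_cast; ring) ⟨by linarith [hu.1], by linarith [hu.2]⟩,
      polygonMap_of_mem_Icc' z (k := 0) (c := 0) (by simp) ⟨hu.1, by linarith [hu.2]⟩]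
    have hzn : z (n - 1 + 1) = z 0 := by
      rw [sub_add_cancel]; have := h.periodic 0; rwa [zero_add] at this
    rw [hzn, zero_add, ha, hb]
    push_cast
    ring
  rw [logInc_congr hfg, logInc_const_mul (hasLogOn_segment ha0 hba) (by norm_num), logInc_segment ha0 hba]

/-- **The windows.** On the `j`-th sub-interval, the forward diagonal secant is the segment from
`z (j+1) - z j` to `z (j+2) - z (j+1)`: `P (j+1+v) - P (j+v) = (1-v)(z (j+1) - z j) + v (z (j+2) - z (j+1))`
for `v ∈ [0, 1]`. [cite: Hopf1935, §2] -/
theorem diagSecant_window (h : IsSimplePolygon z n) (j : ℕ) {v : ℝ} (hv : v ∈ Icc (0 : ℝ) 1) :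
    diagSecant z n ((j + v) / (n - 1)) =
      (1 - (v : ℂ)) * (z (j + 1) - z j) + (v : ℂ) * (z (j + 2) - z (j + 1)) := by
  have hn1 : (n : ℝ) - 1 ≠ 0 := by linarith [h.two_lt]
  simp only [diagSecant, secantMap]
  rw [mul_div_cancel₀ _ hn1,
    polygonMap_of_mem_Icc' z (k := j + 1) (c := j + 1) (by push_cast; ring) ⟨by linarith [hv.1], by linarith [hv.2]⟩,
    polygonMap_of_mem_Icc' z (k := j) (c := j) (by simp) ⟨by linarith [hv.1], by linarith [hv.2]⟩,
    show (j : ℤ) + 1 + 1 = j + 2 by ring]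
  push_cast
  ring

/-- The forward diagonal secant has a logarithm on `[0, 1]`. [cite: Hopf1935, §2] -/
theorem IsSimplePolygon.hasLogOn_diagSecant (h : IsSimplePolygon z n) : HasLogOn (diagSecant z n) (Icc 0 1) := by
  refine hasLogOn_Icc ?_ fun u _ => ?_
  · have := continuous_polygonMap z
    unfold diagSecant secantMap
    fun_prop
  · exact sub_ne_zero.2 (h.polygonMap_ne (by linarith) (by linarith [h.two_lt]))

/-- **Increment along the diagonal**: the forward diagonal secant accumulates the exterior
angles at `z 1, …, z (n-1)` (with their modulus parts). [cite: Hopf1935, §2] -/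
theorem logInc_diagSecant (h : IsSimplePolygon z n) :
    logInc (diagSecant z n) =
      ∑ j ∈ Finset.range (n - 1), log ((z (j + 2) - z (j + 1)) / (z (j + 1) - z j)) := by
  obtain ⟨l, hl, hle⟩ := h.hasLogOn_diagSecant
  have hn1 : (0 : ℝ) < n - 1 := by linarith [h.two_lt]
  have hcast : ((n - 1 : ℕ) : ℝ) = n - 1 := by
    rw [Nat.cast_sub (by linarith [h.three_le] : 1 ≤ n)]; simp
  -- each window contributes `l ((j+1)/(n-1)) - l (j/(n-1))`, and also `log (b_j / a_j)`
  have hwin : ∀ j ∈ Finset.range (n - 1),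
      log ((z (j + 2) - z (j + 1)) / (z (j + 1) - z j)) = l ((j + 1 : ℕ) / (n - 1 : ℝ)) - l (j / (n - 1 : ℝ)) := by
    intro j hj
    rw [Finset.mem_range] at hj
    have hj' : (j : ℝ) + 1 ≤ n - 1 := by
      have : j + 1 ≤ n - 1 := hj
      exact_mod_cast hcast ▸ (Nat.cast_le (α := ℝ)).2 this
    have hmaps : MapsTo (fun v : ℝ => (j + v) / (n - 1)) (Icc 0 1) (Icc 0 1) := fun v hv =>
      ⟨div_nonneg (by linarith [hv.1]) hn1.le, (div_le_one hn1).2 (by linarith [hv.2])⟩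
    have key := logInc_comp_of_log (F := diagSecant z n) (T := Icc 0 1) hl hle (γ := fun v : ℝ => (j + v) / (n - 1))
      (by fun_prop) hmaps
    have hval : logInc (diagSecant z n ∘ fun v : ℝ => (j + v) / (n - 1)) =
        log ((z (j + 2) - z (j + 1)) / (z (j + 1) - z j)) := by
      have ha0 : z (j + 1) - z j ≠ 0 := sub_ne_zero.2 (h.ne_succ j)
      have hba : (z (j + 2) - z (j + 1)) / (z (j + 1) - z j) ∈ slitPlane := by
        have := h.div_mem_slitPlane (j + 1)
        rwa [add_sub_cancel_right, show (j : ℤ) + 1 + 1 = j + 2 by ring] at this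
      rw [← logInc_segment ha0 hba]
      exact logInc_congr fun v hv => diagSecant_window h j hv
    rw [← hval, key]
    congr 1 <;> congr 1 <;> push_cast <;> ring
  rw [Finset.sum_congr rfl hwin, Finset.sum_range_sub (fun j : ℕ => l (j / (n - 1 : ℝ))) (n - 1), hcast,
    div_self hn1.ne', Nat.cast_zero, zero_div]
  exact logInc_eq hl hle

/-- **Increment along side `D`** (the diagonal run backwards). [cite: Hopf1935, §2] -/
theorem logInc_hopfD (h : IsSimplePolygon z n) :
    logInc (secantMap z ∘ hopfD n) =
      -∑ j ∈ Finset.range (n - 1), log ((z (j + 2) - z (j + 1)) / (z (j + 1) - z j)) := by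
  rw [← logInc_diagSecant h, ← logInc_reverse h.hasLogOn_diagSecant]
  rfl

end Values

/-! ### The Umlaufsatz -/

section Main

variable {z : ℤ → ℂ} {n : ℕ}

/-- The exterior angle at `z (j + 1)`, `j : ℕ`, with the indices spelled out. [folklore] -/
theorem extAngle_natCast_succ (z : ℤ → ℂ) (j : ℕ) :
    extAngle z ((j + 1 : ℕ) : ℤ) = arg ((z (j + 2) - z (j + 1)) / (z (j + 1) - z j)) := by
  have e1 : ((j + 1 : ℕ) : ℤ) + 1 = (j : ℤ) + 2 := by push_cast; ring
  have e2 : ((j + 1 : ℕ) : ℤ) - 1 = j := by push_cast; ring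
  have e3 : ((j + 1 : ℕ) : ℤ) = (j : ℤ) + 1 := by push_cast; rfl
  rw [extAngle, e1, e2, e3]

/-- The pieces of Hopf's chain stay in the strip. [cite: Hopf1935, §2] -/
theorem IsSimplePolygon.mapsTo_hopf (h : IsSimplePolygon z n) :
    MapsTo (hopfA n) (Icc 0 1) (secantStrip n) ∧ MapsTo (hopfB n) (Icc 0 1) (secantStrip n) ∧
      MapsTo (hopfC n) (Icc 0 1) (secantStrip n) ∧ MapsTo (hopfD n) (Icc 0 1) (secantStrip n) := by
  have h2 := h.two_lt
  refine ⟨fun u hu => ?_, fun u hu => ?_, fun u hu => ?_, fun u hu => ?_⟩ <;>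
    simp only [hopfA, hopfB, hopfC, hopfD, secantStrip, mem_setOf_eq] <;> obtain ⟨hu0, hu1⟩ := hu <;>
    constructor <;> nlinarith

/-- **Hopf's Umlaufsatz for simple closed polygons, normalised**: if `z 0` is a lowest vertex,
the exterior angles sum to `2π` or `-2π`. [cite: Hopf1935, Satz I] -/
theorem IsSimplePolygon.sum_extAngle_eq_of_lowest (h : IsSimplePolygon z n) (hlow : ∀ i, (z 0).im ≤ (z i).im) :
    ∑ i ∈ Finset.range n, extAngle z i = 2 * π ∨ ∑ i ∈ Finset.range n, extAngle z i = -(2 * π) := by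
  -- the chain identity: the increments of the global logarithm along the closed chain cancel
  obtain ⟨L, hL, hLe⟩ := h.hasLogOn_secantMap
  obtain ⟨mA, mB, mC, mD⟩ := h.mapsTo_hopf
  have eA := logInc_comp_of_log hL hLe (γ := hopfA n) (by unfold hopfA; fun_prop) mA
  have eB := logInc_comp_of_log hL hLe (γ := hopfB n) (by unfold hopfB; fun_prop) mB
  have eC := logInc_comp_of_log hL hLe (γ := hopfC n) (by unfold hopfC; fun_prop) mC
  have eD := logInc_comp_of_log hL hLe (γ := hopfD n) (by unfold hopfD; fun_prop) mD
  have chain : logInc (secantMap z ∘ hopfA n) + logInc (secantMap z ∘ hopfB n) +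
      logInc (secantMap z ∘ hopfC n) + logInc (secantMap z ∘ hopfD n) = 0 := by
    rw [eA, eB, eC, eD]
    have e1 : hopfA n 1 = hopfB n 0 := by rw [hopfA, hopfB, Prod.mk.injEq]; exact ⟨by ring, by ring⟩
    have e2 : hopfB n 1 = hopfC n 0 := by rw [hopfB, hopfC, Prod.mk.injEq]; exact ⟨by ring, by ring⟩
    have e3 : hopfC n 1 = hopfD n 0 := by rw [hopfC, hopfD, Prod.mk.injEq]; exact ⟨by ring, by ring⟩
    have e4 : hopfD n 1 = hopfA n 0 := by rw [hopfD, hopfA, Prod.mk.injEq]; exact ⟨by ring, by ring⟩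
    rw [e1, e2, e3, e4]; ring
  -- the values of the four increments
  rw [logInc_hopfA h hlow, logInc_hopfB h, logInc_hopfC h hlow, logInc_hopfD h] at chain
  set a := z 0 - z (n - 1) with ha
  set b := z 1 - z 0 with hb
  have ha0 : a ≠ 0 := by
    rw [ha, ← h.vertex_neg_one, sub_ne_zero]
    have := h.ne_succ (-1); rwa [show (-1 : ℤ) + 1 = 0 by ring] at this
  have hb0 : b ≠ 0 := sub_ne_zero.2 (by have := h.ne_succ 0; rwa [zero_add] at this)
  -- imaginary parts
  have him := congrArg Complex.im chain
  simp only [add_im, sub_im, neg_im, log_im, zero_im, Complex.im_sum] at him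
  -- the target sum, split off the angle at `z 0`
  have hsum : ∑ i ∈ Finset.range n, extAngle z i =
      arg (b / a) + ∑ j ∈ Finset.range (n - 1), arg ((z (j + 2) - z (j + 1)) / (z (j + 1) - z j)) := by
    have hsplit : ∑ i ∈ Finset.range n, extAngle z i =
        ∑ j ∈ Finset.range (n - 1), extAngle z ((j + 1 : ℕ) : ℤ) + extAngle z ((0 : ℕ) : ℤ) := by
      conv_lhs => rw [show n = n - 1 + 1 from (Nat.sub_add_cancel h.pos).symm]
      exact Finset.sum_range_succ' (fun i : ℕ => extAngle z i) (n - 1)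
    rw [hsplit, add_comm]
    congr 1
    · rw [Nat.cast_zero, extAngle, zero_add, zero_sub, h.vertex_neg_one]
    · exact Finset.sum_congr rfl fun j _ => extAngle_natCast_succ z j
  -- notation for the three angles at the base vertex
  set θ₀ := arg (b / a) with hθ
  set A := arg (-I * b) with hA
  set B := arg (I * a) with hB
  have hT : ∑ i ∈ Finset.range n, extAngle z i = 2 * (θ₀ + B - A) := by rw [hsum]; linarith
  -- bounds: the two extreme secant directions point into the upper half-plane
  have hAb : |A| ≤ π / 2 := by
    rw [hA, abs_arg_le_pi_div_two_iff]
    have : (-I * b).re = (z 1).im - (z 0).im := by rw [hb]; simp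
    rw [this]; linarith [hlow 1]
  have hBb : |B| ≤ π / 2 := by
    rw [hB, abs_arg_le_pi_div_two_iff]
    have : (I * a).re = (z (n - 1)).im - (z 0).im := by rw [ha]; simp
    rw [this]; linarith [hlow (n - 1)]
  obtain ⟨hA1, hA2⟩ := abs_le.1 hAb
  obtain ⟨hB1, hB2⟩ := abs_le.1 hBb
  have hθ1 : -π < θ₀ := neg_pi_lt_arg _
  have hθ2 : θ₀ < π := by
    refine lt_of_le_of_ne (arg_le_pi _) ?_
    have := h.arg_div_ne_pi 0
    rwa [zero_add, zero_sub, h.vertex_neg_one] at this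
  -- the congruence `θ₀ ≡ A - B + π (mod 2π)`
  have hcong : ((θ₀ : ℝ) : Real.Angle) = ((A - B + π : ℝ) : Real.Angle) := by
    have h1 : ((arg (b / a) : ℝ) : Real.Angle) = arg b - arg a := arg_div_coe_angle hb0 ha0
    have h2 : ((arg (-I * b) : ℝ) : Real.Angle) = arg (-I) + arg b :=
      arg_mul_coe_angle (neg_ne_zero.2 I_ne_zero) hb0
    have h3 : ((arg (I * a) : ℝ) : Real.Angle) = arg I + arg a := arg_mul_coe_angle I_ne_zero ha0
    have h2' : ((arg b : ℝ) : Real.Angle) = arg (-I * b) - arg (-I) := by rw [h2]; abel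
    have h3' : ((arg a : ℝ) : Real.Angle) = arg (I * a) - arg I := by rw [h3]; abel
    have hpi : ((π : ℝ) : Real.Angle) = ((π / 2 : ℝ) : Real.Angle) - (((-(π / 2)) : ℝ) : Real.Angle) := by
      rw [← Real.Angle.coe_sub]; congr 1; ring
    rw [hθ, hA, hB, h1, h2', h3', arg_neg_I, arg_I, Real.Angle.coe_add, Real.Angle.coe_sub, hpi]
    abel
  obtain ⟨k, hk⟩ := Real.Angle.angle_eq_iff_two_pi_dvd_sub.1 hcong
  -- `k ∈ {-1, 0}`
  have hπ := Real.pi_pos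
  have hk0 : k ≤ 0 := by
    by_contra hcon
    have : (1 : ℝ) ≤ k := by exact_mod_cast (by omega : 1 ≤ k)
    nlinarith
  have hk1 : -1 ≤ k := by
    by_contra hcon
    have : (k : ℝ) ≤ -2 := by exact_mod_cast (by omega : k ≤ -2)
    nlinarith
  rcases (show k = 0 ∨ k = -1 by omega) with rfl | rfl
  · left
    rw [hT]
    push_cast at hk
    linarith
  · right
    rw [hT]
    push_cast at hk
    linarith

/-- Rotating the indices does not change a periodic sum (general shift; the case `i₀ = 1`
exists under the same name in `Literature.MathematicalPhysics.StatisticalMechanics`, see the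
module docstring, "Overlap"). [folklore] -/
theorem sum_range_shift_of_periodic {f : ℤ → ℝ} {n : ℕ} (hf : ∀ i, f (i + n) = f i) (i₀ : ℕ) :
    ∑ i ∈ Finset.range n, f (i + i₀) = ∑ i ∈ Finset.range n, f i := by
  induction i₀ with
  | zero => simp
  | succ m ih =>
    rw [← ih]
    rcases Nat.eq_zero_or_pos n with rfl | hn
    · simp
    · have key : ∑ i ∈ Finset.range n, f (i + (m + 1 : ℕ)) = ∑ i ∈ Finset.range n, f ((i + 1 : ℕ) + m) :=
        Finset.sum_congr rfl fun i _ => by push_cast; ring_nf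
      rw [key]
      conv_lhs => rw [show n = n - 1 + 1 from (Nat.sub_add_cancel hn).symm]
      conv_rhs => rw [show n = n - 1 + 1 from (Nat.sub_add_cancel hn).symm]
      rw [Finset.sum_range_succ (fun i : ℕ => f ((i + 1 : ℕ) + m)), Finset.sum_range_succ' (fun i : ℕ => f (i + m))]
      congr 1
      have := hf ((0 : ℕ) + m)
      rw [← this]
      congr 1
      push_cast
      rw [Nat.cast_sub hn]
      push_cast
      ring

/-- **Hopf's Umlaufsatz for simple closed polygons** (H. Hopf, Compositio Math. 2 (1935), Satz I,
polygonal case): the exterior angles `arg ((z (i+1) - z i) / (z i - z (i-1))) ∈ (-π, π)` of a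
simple closed polygon `z 0, …, z (n-1)` sum to `2π` or to `-2π` — the tangent turns exactly once.
[cite: Hopf1935, Satz I] -/
theorem IsSimplePolygon.sum_extAngle_eq (h : IsSimplePolygon z n) :
    ∑ i ∈ Finset.range n, extAngle z i = 2 * π ∨ ∑ i ∈ Finset.range n, extAngle z i = -(2 * π) := by
  -- re-index so that a lowest vertex comes first
  obtain ⟨i₀, hi₀, hmin⟩ := (Finset.range n).exists_min_image (fun i : ℕ => (z i).im)
    ⟨0, Finset.mem_range.2 h.pos⟩
  set z' : ℤ → ℂ := fun i => z (i + i₀) with hz'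
  have h' : IsSimplePolygon z' n := h.shift i₀
  have hlow : ∀ i, (z' 0).im ≤ (z' i).im := by
    intro i
    simp only [hz', zero_add]
    -- reduce `i + i₀` modulo `n` into `range n`
    have hn0 : (n : ℤ) ≠ 0 := by exact_mod_cast h.pos.ne'
    set r := (i + i₀) % n with hr
    have hr0 : 0 ≤ r := Int.emod_nonneg _ hn0
    have hrn : r < n := Int.emod_lt_of_pos _ (by exact_mod_cast h.pos)
    have heq : z (i + i₀) = z r := by
      have := Int.emod_add_mul_ediv (i + i₀) n
      rw [← hr] at this
      rw [← this, mul_comm]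
      exact h.periodic.int_mul _ _
    rw [heq]
    have := hmin r.toNat (Finset.mem_range.2 (by omega))
    rwa [show ((r.toNat : ℕ) : ℤ) = r from Int.toNat_of_nonneg hr0] at this
  have key := h'.sum_extAngle_eq_of_lowest hlow
  have hper : ∀ i, extAngle z (i + n) = extAngle z i := fun i => by
    simp only [extAngle]
    rw [show i + n + 1 = i + 1 + n by ring, show i + n - 1 = i - 1 + n by ring, h.periodic, h.periodic, h.periodic]
  have hshift : ∑ i ∈ Finset.range n, extAngle z' i = ∑ i ∈ Finset.range n, extAngle z i := by
    have : ∀ i : ℕ, extAngle z' i = extAngle z (i + i₀) := fun i => by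
      simp only [extAngle, hz']
      congr 3 <;> ring_nf
    rw [Finset.sum_congr rfl fun i _ => this i]
    exact sum_range_shift_of_periodic hper i₀
  rwa [hshift] at key

end Main

end Literature.Topology.PlaneTopology
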